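import Summits.AtomisticToContinuum.HydrodynamicLimit.Theorems.EnergyActivityTails.Negative.ExpMomentLattice

/-!
# Negative knowledge for the crux `OneFlightGossipEngine.EnergyActivityTails` (stmt-AtomisticToContinuum-17703):
# the LD strengthening is false for every HOT-GAIN-dominating summand — part 1, pointwise bounds

Sharpening of `ExpMomentLattice.lean` / `ExpMomentFalse.lean` (same crux, same seat, same witness).  The crux-ideate
round 1 isolates, as the "genuinely energetic" residue of the crux once `CollisionActivityTails` is granted, the tail of
the energy RECEIVED from HOT partners: `hotSupplyOf M` (card `coboundary-hot-cold-split`: partner's incoming NORMAL speed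
`> M`, positive part of the gain) and `hotDonorGainOf W₀` (card `cool-gains-ride-impulse`: partner's incoming SPEED
`> W₀`).  These summands are NOT energy-dominating (they vanish on cold-partner records and on losses), so
`expMomentTailsOf_false` does not apply to them as stated.  But the Newton-cradle relay is a HOT witness: on a labelled
event every receiving record has partner normal speed `|⟪W, n⟫| = |c + ⟪η, n⟫| ≥ clo − u ≍ t³` and POSITIVE gain
`(‖η + cn‖² − ‖η‖²)/2 ≥ gRec`, so the same argument refutes the LD currency of EVERY nonnegative summand that dominates
the positive part of the gain on the records of its own particle whose partner arrives with normal speed above ANY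
fixed level `W` (`IsHotGainDominating W F`).  Instances (part 2): both ideator summands at every level, and — since
`partnerNormalSpeed ≤ ‖v_partner⁻‖` and `(gain)⁺ ≤ |gain|` — every energy-dominating summand again.

MORAL for the lines being planned: whichever hot/cold split is adopted, the HOT residue inherits the crux's currency
constraint verbatim — it can be asked in MEAN (`L¹`, `TailsOf`) only; no entropy-inequality / exponential-Chebyshev
transfer of it from the equilibrium reference to the true law at `s > 0` exists.

This part: `gainImpulse`, `partnerNormalSpeed`, `IsHotGainDominating`, `isHotGainDominating_of_isEnergyDominating`,
`collisionSum_ge_of_hotDominating`, `tailSumH_ge`, `exponentH_ge_tail`.  Nothing here asserts a Theses declaration.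
-/

noncomputable section

open Real MeasureTheory
open scoped InnerProductSpace

namespace Summit.AtomisticToContinuum.HydrodynamicLimit.Theorems

namespace EnergyActivityTailsNegative

open Literature.Analysis.FluidPDE Literature.Analysis.FunctionSpaces Literature.MathematicalPhysics.KineticTheory
open EquilibriumClampedCollisionalWindowLDNegative EquilibriumClampedCollisionalWindowLDNegative.Lat
open TransferActivityTailsNegative (gRec gRec_nonneg gainT_le)

/-! ## Hot-gain domination -/

/-- The SIGNED kinetic-energy gain `(‖v⁺‖² − ‖v⁻‖²)/2` of the first particle of a record (`energyImpulse = |gainImpulse|`). -/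
def gainImpulse {N : ℕ} (c : Rec N) : ℝ := (‖c.postVel.1‖ ^ 2 - ‖c.preVel.1‖ ^ 2) / 2

/-- The PARTNER's incoming normal speed `|⟪v_snd⁻, ω⟫|/‖ω‖` along the impact vector of the record (the card
`coboundary-hot-cold-split`'s `partnerNormalSpeed`, verbatim; junk-safe: `0` at `ω = 0`). -/
def partnerNormalSpeed {N : ℕ} (c : Rec N) : ℝ := |⟪c.preVel.2, c.impactVec⟫_ℝ| / ‖c.impactVec‖

/-- The energy impulse is the absolute value of the signed gain. -/
theorem energyImpulse_eq_abs_gainImpulse {N : ℕ} (c : Rec N) : energyImpulse c = |gainImpulse c| := by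
  unfold energyImpulse gainImpulse
  rw [abs_div, abs_two]

/-- A per-record summand family is HOT-GAIN-DOMINATING at level `W` if it is nonnegative and, on the records of its own
particle whose partner arrives with normal speed `> W`, at least the positive part of the gain (instances: the ideators'
`hotSupplyOf M` for `M ≤ W` and `hotDonorGainOf W₀` for `W₀ ≤ W`; every energy-dominating summand, at every `W`). -/
def IsHotGainDominating (W : ℝ) (F : (N : ℕ) → Fin (N + 1) → Rec N → ℝ) : Prop :=
  (∀ N i c, 0 ≤ F N i c) ∧ ∀ N i (c : Rec N), c.fst = i → W < partnerNormalSpeed c → max (gainImpulse c) 0 ≤ F N i c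

/-- Energy-dominating summands are hot-gain-dominating at every level. -/
theorem isHotGainDominating_of_isEnergyDominating {F : (N : ℕ) → Fin (N + 1) → Rec N → ℝ}
    (hF : IsEnergyDominating F) (W : ℝ) : IsHotGainDominating W F := by
  refine ⟨hF.1, fun N i c hi _ => le_trans ?_ (hF.2 N i c hi)⟩
  rw [energyImpulse_eq_abs_gainImpulse]
  exact max_le (le_abs_self _) (abs_nonneg _)

/-- Monotonicity in the level: domination at level `W` gives domination at every higher level. -/
theorem IsHotGainDominating.mono {W W' : ℝ} {F : (N : ℕ) → Fin (N + 1) → Rec N → ℝ}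
    (hF : IsHotGainDominating W F) (hWW' : W ≤ W') : IsHotGainDominating W' F :=
  ⟨hF.1, fun N i c hi hW' => hF.2 N i c hi (hWW'.trans_lt hW')⟩

/-! ## The receiving records of the relay are hot and gain `≥ gRec` -/

section Lattice

variable {Λ : EquilibriumClampedCollisionalWindowLDNegative.Lat} {N : ℕ} {a : Fin (N + 1) ≃ Λ.Slot}
variable {Φ : HardSphereFlow (Torus.geometry (Fin 3)) Λ.P.ε (N + 1)}

/-- **The receiving sphere of a transfer is hot-supplied and hyperactive**: if `W < clo − u`, its windowed `F`-sum is at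
least `gRec` for every `F` hot-gain-dominating at level `W` (receiving record: partner = the carrier, `preVel.2 = W_c`,
impact vector `= n`, `|⟪W_c, n⟫| = |c + ⟪η, n⟫| ≥ c − u ≥ clo − u > W`; gain `= (‖η + cn‖² − ‖η‖²)/2 ≥ clo(clo−2u)/2`). -/
theorem collisionSum_ge_of_hotDominating (hW : Λ.WinOK) (hG : Λ.GainOK) (hε : Λ.P.ε < 1 / 2) {z : Cfg N}
    (hz : z ∈ Λ.Ev a) (hgood : z ∈ Φ.good) {W : ℝ} {F : Fin (N + 1) → Rec N → ℝ} (hF0 : ∀ p c, 0 ≤ F p c)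
    (hFE : ∀ p (c : Rec N), c.fst = p → W < partnerNormalSpeed c → max (gainImpulse c) 0 ≤ F p c)
    (hWlt : W < Λ.P.clo - Λ.P.u)
    {tr : ℕ × (Fin Λ.n × Fin Λ.n) × ℕ} (htr : tr ∈ Λ.transfers a z) :
    gRec Λ.P ≤ Φ.collisionSum (Set.Ioc 0 Λ.w) (F (Λ.sphJ a tr)) z := by
  classical
  have hΛ := hW.ok
  have hP := hΛ.sep.adm
  rw [collisionSum_window hW hε hz hgood]
  have hnn : ∀ tr' ∈ Λ.transfers a z, 0 ≤
      F (Λ.sphJ a tr) (HardSphereCollisionRecord.ofConfig (Torus.geometry (Fin 3)) Λ.P.ε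
          (Λ.cert a z (Λ.ttime a z tr')) (Λ.ttime a z tr') (Λ.sphI a tr') (Λ.sphJ a tr')) +
        F (Λ.sphJ a tr) (HardSphereCollisionRecord.ofConfig (Torus.geometry (Fin 3)) Λ.P.ε
          (Λ.cert a z (Λ.ttime a z tr')) (Λ.ttime a z tr') (Λ.sphJ a tr') (Λ.sphI a tr')) :=
    fun tr' _ => add_nonneg (hF0 _ _) (hF0 _ _)
  refine le_trans ?_ (Finset.single_le_sum hnn htr)
  -- the receiving record of `tr`
  obtain ⟨hb, hj, hact, -⟩ := mem_transfers.1 htr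
  have hD := dataOK_of_mem hΛ hz hact tr.2.1
  have hf := stepFacts hP hD (by omega : tr.2.2 + 1 ≤ Λ.P.K)
  have hn1 : ‖Λ.trN a z tr‖ = 1 := hf.cont.n_unit
  have hε0 : Λ.P.ε ≠ 0 := hP.ε_pos.ne'
  obtain ⟨-, hpj⟩ := preVel_transfer hW hz htr
  obtain ⟨hvi, hvj⟩ := cert_snd_transfer hW hz htr
  -- the impact vector of the receiving record is the unit normal `n`
  have hsv := sepVec_sph hW hz htr
  have hsv' : (Torus.geometry (Fin 3)).sepVec (Λ.cert a z (Λ.ttime a z tr) (Λ.sphJ a tr)).1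
      (Λ.cert a z (Λ.ttime a z tr) (Λ.sphI a tr)).1 = Λ.P.ε • Λ.trN a z tr := by
    have hreg := regular hP hε
    rw [hreg.sepVec_comm _ _ (by rw [hsv, norm_neg, norm_smul, hn1, mul_one, Real.norm_of_nonneg hP.ε_pos.le]),
      hsv, neg_neg]
  set c := Λ.trC a z tr with hc
  set n := Λ.trN a z tr with hn
  set Wc := Λ.trW a z tr with hWc
  set η := Λ.trη a z tr with hη
  have hcdef : c = ⟪Wc - η, n⟫_ℝ := rfl
  have hcge : Λ.P.clo ≤ c := hf.cont.c_ge
  have hηu : ‖η‖ ≤ Λ.P.u := hD.η_le (tr.2.2 + 1) (by omega) (by omega)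
  have hu := hP.u_nn
  have hclo := hP.clo_pos
  have hc0 : 0 ≤ c := hclo.le.trans hcge
  -- partner normal speed of the receiving record
  have hηn : |⟪η, n⟫_ℝ| ≤ Λ.P.u := by
    have h1 := abs_real_inner_le_norm η n
    rw [hn1, mul_one] at h1
    exact h1.trans hηu
  have hWn : Λ.P.clo - Λ.P.u ≤ |⟪Wc, n⟫_ℝ| := by
    have e : ⟪Wc, n⟫_ℝ = c + ⟪η, n⟫_ℝ := by rw [hcdef, inner_sub_left]; ring
    rw [e]
    have := neg_abs_le (⟪η, n⟫_ℝ)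
    have h2 : c + ⟪η, n⟫_ℝ ≤ |c + ⟪η, n⟫_ℝ| := le_abs_self _
    linarith
  have hhot : W < partnerNormalSpeed (HardSphereCollisionRecord.ofConfig (Torus.geometry (Fin 3)) Λ.P.ε
      (Λ.cert a z (Λ.ttime a z tr)) (Λ.ttime a z tr) (Λ.sphJ a tr) (Λ.sphI a tr)) := by
    unfold partnerNormalSpeed
    rw [HardSphereCollisionRecord.ofConfig_impactVec, hsv', smul_smul, inv_mul_cancel₀ hε0, one_smul, hpj, hn1,
      div_one]
    exact hWlt.trans_le hWn
  -- the gain of the receiver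
  have hexp : ‖η + c • n‖ ^ 2 - ‖η‖ ^ 2 = 2 * (c * ⟪η, n⟫_ℝ) + c ^ 2 := by
    rw [norm_add_sq_real, real_inner_smul_right, norm_smul, hn1, mul_one, Real.norm_eq_abs, sq_abs]; ring
  have hin : -Λ.P.u ≤ ⟪η, n⟫_ℝ := by
    have := neg_abs_le (⟪η, n⟫_ℝ); linarith
  have hin' : c * (-Λ.P.u) ≤ c * ⟪η, n⟫_ℝ := mul_le_mul_of_nonneg_left hin hc0
  have hmono : Λ.P.clo * (Λ.P.clo - 2 * Λ.P.u) ≤ c ^ 2 - 2 * (c * Λ.P.u) := by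
    have h := mul_nonneg (sub_nonneg.2 hcge) (by linarith [hG.u_le] : 0 ≤ c + Λ.P.clo - 2 * Λ.P.u)
    nlinarith [h]
  have hB : Λ.P.clo * (Λ.P.clo - 2 * Λ.P.u) ≤ ‖η + c • n‖ ^ 2 - ‖η‖ ^ 2 := by rw [hexp]; linarith
  -- drop the giving record, read the receiving one through the domination hypothesis
  refine le_trans ?_ (le_add_of_nonneg_left (hF0 _ _))
  refine le_trans ?_ (hFE _ _ (HardSphereCollisionRecord.ofConfig_fst _ _ _ _ _ _) hhot)
  refine le_trans ?_ (le_max_left _ _)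
  unfold gainImpulse
  simp only [HardSphereCollisionRecord.ofConfig_postVel, hpj, hvj]
  unfold gRec
  linarith

/-- **The tail sum on a labelled event** (hot version). -/
theorem tailSumH_ge (hW : Λ.WinOK) (hG : Λ.GainOK) (hε : Λ.P.ε < 1 / 2) {z : Cfg N} (hz : z ∈ Λ.Ev a)
    (hgood : z ∈ Φ.good) {W : ℝ} {F : Fin (N + 1) → Rec N → ℝ} (hF0 : ∀ p c, 0 ≤ F p c)
    (hFE : ∀ p (c : Rec N), c.fst = p → W < partnerNormalSpeed c → max (gainImpulse c) 0 ≤ F p c)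
    (hWlt : W < Λ.P.clo - Λ.P.u)
    {κ V : ℝ} (hκ : 0 ≤ κ) (hV : V < κ * gRec Λ.P) {kw : ℕ} (hkK : kw + 1 ≤ Λ.P.K)
    (hkw : (kw : ℝ) * Λ.P.θhi ≤ Λ.w) (hM : 24 * Λ.m ≤ Λ.M) :
    Λ.Tlow kw * (κ * gRec Λ.P) ≤
      ∑ p : Fin (N + 1), Set.indicator {y : ℝ | V < y} (fun y => y) (actF Λ Φ F κ p z) := by
  classical
  have hΛ := hW.ok
  have hg0 := gRec_nonneg hΛ hG
  have hact0 : ∀ p, 0 ≤ actF Λ Φ F κ p z := by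
    intro p
    unfold actF
    refine mul_nonneg hκ ?_
    rw [HardSphereFlow.collisionSum_eq, collisionSum_eq_collisionPairSum]
    exact collisionPairSum_nonneg fun _ _ _ => hF0 _ _
  have htail0 : ∀ p, 0 ≤ Set.indicator {y : ℝ | V < y} (fun y => y) (actF Λ Φ F κ p z) := fun p =>
    Set.indicator_apply_nonneg fun _ => hact0 p
  have hrecv : ∀ tr ∈ Λ.transfers a z,
      κ * gRec Λ.P ≤ Set.indicator {y : ℝ | V < y} (fun y => y) (actF Λ Φ F κ (Λ.sphJ a tr) z) := by
    intro tr htr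
    have h1 : κ * gRec Λ.P ≤ actF Λ Φ F κ (Λ.sphJ a tr) z :=
      mul_le_mul_of_nonneg_left (collisionSum_ge_of_hotDominating hW hG hε hz hgood hF0 hFE hWlt htr) hκ
    rw [Set.indicator_of_mem (show actF Λ Φ F κ (Λ.sphJ a tr) z ∈ {y : ℝ | V < y} from hV.trans_le h1)]
    exact h1
  have hT : Λ.Tlow kw ≤ ((Λ.transfers a z).card : ℝ) := by
    have h1 := card_transfers_ge (a := a) hΛ hz hkK hkw
    have h2 := card_active_ge Λ hΛ hM
    have h1' : ((((Finset.range Λ.Q).filter Λ.Active).card * (Λ.n * Λ.n) * kw : ℕ) : ℝ) ≤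
        (Λ.transfers a z).card := by
      exact_mod_cast h1
    push_cast at h1'
    unfold Lat.Tlow
    have : (0 : ℝ) ≤ (Λ.n : ℝ) * Λ.n * kw := by positivity
    nlinarith
  calc Λ.Tlow kw * (κ * gRec Λ.P) ≤ ((Λ.transfers a z).card : ℝ) * (κ * gRec Λ.P) :=
        mul_le_mul_of_nonneg_right hT (mul_nonneg hκ hg0)
    _ = ∑ _tr ∈ Λ.transfers a z, κ * gRec Λ.P := by rw [Finset.sum_const, nsmul_eq_mul]
    _ ≤ ∑ tr ∈ Λ.transfers a z, Set.indicator {y : ℝ | V < y} (fun y => y) (actF Λ Φ F κ (Λ.sphJ a tr) z) :=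
        Finset.sum_le_sum hrecv
    _ = ∑ p ∈ (Λ.transfers a z).image (Λ.sphJ a),
          Set.indicator {y : ℝ | V < y} (fun y => y) (actF Λ Φ F κ p z) := by
        rw [Finset.sum_image fun tr htr tr' htr' h => sphJ_inj hΛ htr htr' h]
    _ ≤ ∑ p : Fin (N + 1), Set.indicator {y : ℝ | V < y} (fun y => y) (actF Λ Φ F κ p z) :=
        Finset.sum_le_univ_sum_of_nonneg fun p => htail0 p

/-- **Pointwise exponent bound on a labelled event** (hot version). -/
theorem exponentH_ge_tail (hW : Λ.WinOK) (hG : Λ.GainOK) (hε : Λ.P.ε < 1 / 2) (hw0 : 0 < Λ.w) {z : Cfg N}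
    (hz : z ∈ Λ.Ev a) (hgood : z ∈ Φ.good) {W : ℝ} {F : Fin (N + 1) → Rec N → ℝ} (hF0 : ∀ p c, 0 ≤ F p c)
    (hFE : ∀ p (c : Rec N), c.fst = p → W < partnerNormalSpeed c → max (gainImpulse c) 0 ≤ F p c)
    (hWlt : W < Λ.P.clo - Λ.P.u)
    {κ V β B : ℝ} (hκ : 0 ≤ κ) (hV : V < κ * gRec Λ.P) (hβ : 0 ≤ β)
    (hB : 2 * β ≤ B) (hκε : Λ.P.ε ≤ κ * Λ.w) {kw : ℕ} (hkK : kw + 1 ≤ Λ.P.K) (hkw : (kw : ℝ) * Λ.P.θhi ≤ Λ.w)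
    (hM : 24 * Λ.m ≤ Λ.M) :
    Λ.Fmin N kw β 1 ≤ B * ∑ p : Fin (N + 1), Set.indicator {y : ℝ | V < y} (fun y => y) (actF Λ Φ F κ p z) := by
  have hΛ := hW.ok
  have hg0 := gRec_nonneg hΛ hG
  have hS := tailSumH_ge hW hG hε hz hgood hF0 hFE hWlt hκ hV hkK hkw hM
  have hS0 : 0 ≤ ∑ p : Fin (N + 1), Set.indicator {y : ℝ | V < y} (fun y => y) (actF Λ Φ F κ p z) :=
    le_trans (mul_nonneg (by unfold Lat.Tlow; positivity) (mul_nonneg hκ hg0)) hS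
  have hT0 : 0 ≤ Λ.Tlow kw := by unfold Lat.Tlow; positivity
  have hwi : 0 < Λ.w⁻¹ := inv_pos.2 hw0
  have hgain : Λ.w⁻¹ * gainT Λ.P ≤ 2 * (κ * gRec Λ.P) := by
    have h1 : Λ.w⁻¹ * gainT Λ.P ≤ Λ.w⁻¹ * (2 * Λ.P.ε * gRec Λ.P) :=
      mul_le_mul_of_nonneg_left (gainT_le hΛ hG) hwi.le
    have h2 : Λ.w⁻¹ * Λ.P.ε ≤ κ := by
      rw [inv_mul_le_iff₀ hw0]; linarith [hκε]
    calc Λ.w⁻¹ * gainT Λ.P ≤ Λ.w⁻¹ * (2 * Λ.P.ε * gRec Λ.P) := h1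
      _ = 2 * (Λ.w⁻¹ * Λ.P.ε) * gRec Λ.P := by ring
      _ ≤ 2 * κ * gRec Λ.P := by gcongr
      _ = 2 * (κ * gRec Λ.P) := by ring
  have hmain : Λ.w⁻¹ * (Λ.Tlow kw * gainT Λ.P) ≤
      2 * ∑ p : Fin (N + 1), Set.indicator {y : ℝ | V < y} (fun y => y) (actF Λ Φ F κ p z) := by
    calc Λ.w⁻¹ * (Λ.Tlow kw * gainT Λ.P) = Λ.Tlow kw * (Λ.w⁻¹ * gainT Λ.P) := by ring
      _ ≤ Λ.Tlow kw * (2 * (κ * gRec Λ.P)) := mul_le_mul_of_nonneg_left hgain hT0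
      _ = 2 * (Λ.Tlow kw * (κ * gRec Λ.P)) := by ring
      _ ≤ _ := by linarith [hS]
  unfold Lat.Fmin
  simp only [sub_self, abs_zero, zero_mul, mul_zero, sub_zero]
  calc β * (Λ.w⁻¹ * (Λ.Tlow kw * gainT Λ.P))
      ≤ β * (2 * ∑ p : Fin (N + 1), Set.indicator {y : ℝ | V < y} (fun y => y) (actF Λ Φ F κ p z)) :=
        mul_le_mul_of_nonneg_left hmain hβ
    _ = (2 * β) * ∑ p : Fin (N + 1), Set.indicator {y : ℝ | V < y} (fun y => y) (actF Λ Φ F κ p z) := by ring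
    _ ≤ B * ∑ p : Fin (N + 1), Set.indicator {y : ℝ | V < y} (fun y => y) (actF Λ Φ F κ p z) :=
        mul_le_mul_of_nonneg_right hB hS0

end Lattice

end EnergyActivityTailsNegative

end Summit.AtomisticToContinuum.HydrodynamicLimit.Theorems

end
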